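import Summits.BirchSwinnertonDyer.BirchSwinnertonDyer.Theorems.KolyvaginDepthDoorDepthTableRowRankThree5077a1NoTwist
import HarnessLib

/-!
# Route `KolyvaginDepthDoor` — the depth table BEYOND RANK 2, part 4: DEPTH-TWO rows `11642a1`, `13766a1`
# at `p = 5` (Heegner fields `d_K` as stated per row), twist-free and without Kolyvagin's structure theorem (crux `KolyvaginDepthSupply`,
# stmt-BirchSwinnertonDyer-21765)

Helper file (`--supports stmt-BirchSwinnertonDyer-21765 --as helper`); it closes nothing and BSD is
not proved by it.

Sequel of `…DepthTableRowRankThree5077a1NoTwist` (module docstring there): further curves of the tree's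
kernel-certified rank-3 atlas (`atlasR3A00`: `3 ≤ rank_ℤ` proved, `three_le_rank_of_mem_atlasR3A00`) with
composite `|Δ|` (two prime factors; Heegner hypothesis via `forall_prime_dvd_of_natAbs_eq_pow_mul_pow`), read through the depth-two kit `depthRowTwo_noTwist_of_print_of_intModel_certificate`:
for each, `5 ∈ B(E)` (semistable, a Mazur Frobenius witness, the multiplicative prime `N ∥ Δ`), non-CM,
the Heegner hypothesis for `d_K = −7` (`(−7/N) = 1`) and the two smallest Kolyvagin primes `ℓ₁ < ℓ₂`
(inert in `ℚ(√−7)`, `5 ∣ ℓ + 1`, `5 ∣ a_ℓ` — point counts by the tree's `ℕ`-arithmetic Euler count) are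
decided in the kernel; the row concludes, from the depth-2 bit `(d (ℓ₁ℓ₂)).kolyvaginClass _ 1 ≠ 0`:
`corank_{ℤ_5} Ш(E)[5^∞] = 0`, `rank_ℤ E(ℚ) = 3`, `rank_ℤ E^{(−7)}(ℚ) ≤ 2`, `E(ℚ)[5] = 0`, `Ш(E/ℚ)[5] = 0`,
`#Sel^(5)(E/ℚ) = 125`, `#Sel^(5)(E^{(−7)}/ℚ) ≤ 25`.

HONEST FRAMING: shape + side conditions only; the depth-2 bit (a JLS computation at conductor `ℓ₁ℓ₂`) is
not run. CONDITIONAL on the five named McCallum/Gross leaves, the compatible system and the bit; NO twist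
point, NO `hF`; per-curve; BSD is not proved by it.

References: [CremonaAlgorithms1997] Table 1; [Kolyvagin1991MathAnn] Thm. 2.3; [GrossLMS1991] §5 (5.1), §10;
[McCallumLMS1991] §§2–5; [WZhang2014] Notations (xii); [Serre1972] §5.4 Prop. 21.
-/

set_option linter.dupNamespace false

noncomputable section

open scoped Classical NumberField

namespace Summit.BirchSwinnertonDyer.BirchSwinnertonDyer.Theorems.KolyvaginDepthDoor

open Literature.NumberTheory.EllipticCurves Literature.NumberTheory.EllipticCurves.ModularForms
  Literature.NumberTheory.EllipticCurves.McCallum1991 WeierstrassCurve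
open Summit.BirchSwinnertonDyer.BirchSwinnertonDyer.Theorems
open Summit.BirchSwinnertonDyer.BirchSwinnertonDyer.Rank2Observatory
open Summit.BirchSwinnertonDyer.BirchSwinnertonDyer.Rank1Residual
open Summit.BirchSwinnertonDyer.Rank1Residual.Additive

namespace C11642a1

/-- `11642a1` is a curve of the rank-3 atlas table `atlasR3A00`. [cite: CremonaAlgorithms1997, Table 1 (11642a1)] -/
theorem mem_atlas : c11642a1 ∈ atlasR3A00 := by simp [atlasR3A00]

/-- The integral model `[1, -1, 0, -16, 28]` of `11642a1` is the tree's `integralModelInt` of the atlas curve.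
[cite: CremonaAlgorithms1997, Table 1 (11642a1)] -/
theorem intModel :
    haveI := isElliptic_of_mem_atlasR3A00 mem_atlas;
    haveI := isGloballyMinimal_of_mem_atlasR3A00 mem_atlas;
    integralModelInt (c11642a1.e.baseChange ℚ) = ⟨1, -1, 0, -16, 28⟩ := by
  haveI := isElliptic_of_mem_atlasR3A00 mem_atlas
  haveI := isGloballyMinimal_of_mem_atlasR3A00 mem_atlas
  exact IntModel.integralModelInt_eq_of_map_eq _ rfl

/-- `#Ẽ(𝔽_3) = 7`, `a_3 = -3` for `11642a1` (Mazur witness: `X² − a_3X + 3` is root-free mod `5`), kernel-decided.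
[cite: CremonaAlgorithms1997, Table 1 (11642a1)] -/
theorem card_3 :
    Nat.card (((⟨1, -1, 0, -16, 28⟩ : WeierstrassCurve ℤ).map (Int.castRingHom (ZMod 3))).toAffine.Point) = 7 := by
  rw [PointCountNat.natCard_point_map_eq (hℓ := ⟨by norm_num⟩) (by norm_num) 1 (-1) 0 (-16) (28)
    (by decide +kernel)]
  decide +kernel

/-- **`5 ∈ B(11642a1)`: `ρ̄_{E,5^m}` onto for every `m`** (unconditional): semistable (`gcd(c₄, Δ) = 1`,
`c₄ = 777`, `|Δ| = 2^2·5821^1`), `E[5]` irreducible by the Frobenius witness at `3` (Mazur) hence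
`ρ̄_{E,5}` onto (Serre Prop. 21), and the multiplicative prime `5821` (`5821^1 ∥ Δ`, `5 ∤ 1`) lifts the image
to `GL₂(ℤ/5^m)`. [cite: Serre1972, §5.4 Prop. 21] [cite: SerreAbelianLadic1968, Ch. IV §3.4] -/
theorem hasSurjectiveModNGaloisRep_pow_5 (m : ℕ) : (c11642a1.e.baseChange ℚ).HasSurjectiveModNGaloisRep (5 ^ m : ℕ) := by
  have hn : ∀ t : ZMod 5, t ^ 2 - (((3 : ℕ) : ℤ) + 1 - (7 : ℕ) : ℤ) * t + ((3 : ℕ) : ZMod 5) ≠ 0 := by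
    decide +kernel
  haveI := isElliptic_of_mem_atlasR3A00 mem_atlas
  haveI := isGloballyMinimal_of_mem_atlasR3A00 mem_atlas
  haveI := Fact.mk (by norm_num : Nat.Prime 5)
  haveI := Fact.mk (by norm_num : Nat.Prime 3)
  exact hasSurjectiveModNGaloisRep_pow_of_intModel_certificate intModel
    (by rw [Int.isCoprime_iff_gcd_eq_one]; decide +kernel) 5 3 (by norm_num) (by decide +kernel)
    (n := 7) card_3 hn 5821 (by norm_num) (by norm_num) (by decide +kernel) (by decide +kernel)
    (e := 1) (by decide +kernel) (by decide +kernel) (by decide +kernel) m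

/-- **`11642a1` is not CM** (unconditional): multiplicative reduction at `5821` (`5821 ∣ Δ`, `5821 ∤ c₄ = 777`);
a CM curve over `ℚ` has no multiplicative prime. [cite: SilvermanATAEC1994, Thm. II.6.4 (PDF p. 148)]
[cite: CremonaAlgorithms1997, Table 1 (11642a1)] -/
theorem not_hasCM :
    haveI := isElliptic_of_mem_atlasR3A00 mem_atlas;
    ¬ (c11642a1.e.baseChange ℚ).HasCM := by
  haveI := isElliptic_of_mem_atlasR3A00 mem_atlas
  haveI := isGloballyMinimal_of_mem_atlasR3A00 mem_atlas
  haveI := Fact.mk (by norm_num : Nat.Prime 5821)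
  intro hCM
  exact not_hasMultiplicativeReductionAtPrime_of_hasCM _ hCM 5821
    (IntModel.hasMultiplicativeReductionAtPrime_of_intModel intModel 5821 (by decide +kernel)
      (by decide +kernel))

/-- **Heegner data `d_K = -7` for `11642a1`**: every prime of `|Δ| = 2^2·5821^1` splits in a quadratic field of
discriminant `-7` (Kronecker symbols `= 1`). [cite: Marcus1977, Ch. 3 Thm. 25] [cite: GrossLMS1991, §1] -/
theorem heegner_neg7 : ∀ q : ℕ, q.Prime → (q : ℤ) ∣ (⟨1, -1, 0, -16, 28⟩ : WeierstrassCurve ℤ).Δ →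
    (q = 2 → (-7 : ℤ) % 8 = 1) ∧ (q ≠ 2 → jacobiSym (-7) q = 1) :=
  forall_prime_dvd_of_natAbs_eq_pow_mul_pow (a := 2) (i := 2) (b := 5821) (j := 1) (by decide +kernel)
    (by norm_num) (by norm_num) ⟨by norm_num, by norm_num⟩ ⟨by norm_num, by norm_num⟩

/-- `#Ẽ(𝔽_19) = 25`, `a_19 = -5` (Kolyvagin prime for `(5, -7)`: `(-7/19) = −1`, `5 ∣ 20`, `5 ∣ a_19`),
kernel-decided. [cite: CremonaAlgorithms1997, Table 1 (11642a1)] -/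
theorem card_19 :
    Nat.card (((⟨1, -1, 0, -16, 28⟩ : WeierstrassCurve ℤ).map (Int.castRingHom (ZMod 19))).toAffine.Point) = 25 := by
  rw [PointCountNat.natCard_point_map_eq (hℓ := ⟨by norm_num⟩) (by norm_num) 1 (-1) 0 (-16) (28)
    (by decide +kernel)]
  decide +kernel

/-- `#Ẽ(𝔽_59) = 60`, `a_59 = 0` (Kolyvagin prime for `(5, -7)`: `(-7/59) = −1`, `5 ∣ 60`, `5 ∣ a_59`),
kernel-decided. [cite: CremonaAlgorithms1997, Table 1 (11642a1)] -/
theorem card_59 :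
    Nat.card (((⟨1, -1, 0, -16, 28⟩ : WeierstrassCurve ℤ).map (Int.castRingHom (ZMod 59))).toAffine.Point) = 60 := by
  rw [PointCountNat.natCard_point_map_eq (hℓ := ⟨by norm_num⟩) (by norm_num) 1 (-1) 0 (-16) (28)
    (by decide +kernel)]
  decide +kernel

/-- **`3 ≤ rank_ℤ E(ℚ)` for `11642a1`** (the tree's kernel census theorem `three_le_rank_of_mem_atlasR3A00`,
transported along `C.e ⊗ ℚ = C.row.curve`). [cite: CremonaAlgorithms1997, Table 1 (11642a1)] -/
theorem three_le_rank : 3 ≤ (c11642a1.e.baseChange ℚ).mordellWeilRank := by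
  have hbc : c11642a1.e.baseChange ℚ = c11642a1.row.curve := by
    ext <;> simp [AtlasCurve3.e, Rank3Row.curve, WeierstrassCurve.baseChange]
  rw [hbc]
  exact three_le_rank_of_mem_atlasR3A00 mem_atlas

/-- **DEPTH-TWO ROW `11642a1`, `(p, d_K, ℓ₁ℓ₂) = (5, -7, 19·59)`, twist-free, without Kolyvagin's
structure theorem.** For `E = 11642a1` (rank `3`), ANY imaginary quadratic `K` with `d_K = -7`, any frame
`(Dt, β, ι)` and any COMPATIBLE system `d n` of Kolyvagin–Heegner data, granted the five named leaves
(Gross Prop. 5.4 (2); McCallum Lemma 4.3, Prop. 4.4, Lemma 5.3, Prop. 2.2): IF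
`(d (19 * 59)).kolyvaginClass _ 1 ≠ 0` THEN `corank_{ℤ_5} Ш(E)[5^∞] = 0`, `rank_ℤ E(ℚ) = 3`,
`rank_ℤ E^{(-7)}(ℚ) ≤ 2`, `E(ℚ)[5] = 0`, `Ш(E/ℚ)[5] = 0`, `#Sel^(5)(E/ℚ) = 5³`, `#Sel^(5)(E^{(-7)}/ℚ) ≤ 5²`.
Every side condition is a kernel theorem. CONDITIONAL on the five facts and the bit; per-curve; BSD is not
proved by it. [cite: Kolyvagin1991MathAnn, Thm. 2.3] [cite: McCallumLMS1991, §§2–5]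
[cite: GrossLMS1991, §5 (5.1)] [cite: CremonaAlgorithms1997, Table 1 (11642a1)] -/
theorem depthRow_5_neg7_19_59_noTwist
    (h54 : sign_conjAct_kolyvaginClass) (h43 : lemma43_kolyvaginClass_mem_selmerLocalKer)
    (h44 : prop44_localOrder_kolyvaginClass_mul_eq) (h53 : lemma53_selmer_eigen_dependent_at)
    (h22 : prop22_reciprocity_eigen_finset)
    (K : Type) [Field K] [NumberField K] (hK : IsImaginaryQuadratic K)
    (hD : NumberField.discr K = -7) :
    haveI := isElliptic_of_mem_atlasR3A00 mem_atlas;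
    haveI := isGloballyMinimal_of_mem_atlasR3A00 mem_atlas;
    haveI : NeZero ((c11642a1.e.baseChange ℚ).conductorNorm ℤ) := neZero_conductorNorm_of_isElliptic _;
    ∀ (Dt : ModularParametrizationData (c11642a1.e.baseChange ℚ) ((c11642a1.e.baseChange ℚ).conductorNorm ℤ))
      (β : ℤ) (ι : K →+* ℂ) (d : ∀ m : ℕ, KolyvaginHeegnerData Dt β ι m),
    (∀ (m l : ℕ), ∀ l' ∈ m.primeFactors, ∀ (x : ringClassField K ι m)
      (x' : ringClassField K ι (m * l)),
      (x : ℂ) = x' → (((d (m * l)).σ l' x' : ringClassField K ι (m * l)) : ℂ) = ((d m).σ l' x : ℂ)) →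
    (∀ (m l : ℕ), ∀ s ∈ (d m).S, ∃ s' ∈ (d (m * l)).S, ∀ (x : ringClassField K ι m)
      (x' : ringClassField K ι (m * l)),
      (x : ℂ) = x' → ((s' x' : ringClassField K ι (m * l)) : ℂ) = (s x : ℂ)) →
    (∀ (m l : ℕ), ∀ s' ∈ (d (m * l)).S, ∃ s ∈ (d m).S, ∀ (x : ringClassField K ι m)
      (x' : ringClassField K ι (m * l)),
      (x : ℂ) = x' → ((s' x' : ringClassField K ι (m * l)) : ℂ) = (s x : ℂ)) →
    (∀ (m l : ℕ) (x : ringClassField K ι m) (x' : ringClassField K ι (m * l)),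
      (x : ℂ) = x' → (d (m * l)).emb x' = (d m).emb x) →
    (d (19 * 59)).kolyvaginClass (p := 5) (by norm_num) 1 ≠ 0 →
    (c11642a1.e.baseChange ℚ).shaCorank 5 = 0 ∧ (c11642a1.e.baseChange ℚ).mordellWeilRank = 3 ∧
      ((c11642a1.e.baseChange ℚ).quadraticTwist ((-7 : ℤ) : ℚ)).mordellWeilRank ≤ 2 ∧
      (∀ P : (c11642a1.e.baseChange ℚ).toAffine.Point, 5 • P = 0 → P = 0) ∧
      (∀ x ∈ (c11642a1.e.baseChange ℚ).sha, 5 • x = 0 → x = 0) ∧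
      Nat.card ↥(selmerGroup (c11642a1.e.baseChange ℚ) ((5 : ℕ) : ℤ)) = 5 ^ 3 ∧
      Nat.card ↥(selmerGroup ((c11642a1.e.baseChange ℚ).quadraticTwist ((-7 : ℤ) : ℚ)) ((5 : ℕ) : ℤ)) ≤ 5 ^ 2 := by
  haveI := isElliptic_of_mem_atlasR3A00 mem_atlas
  haveI := isGloballyMinimal_of_mem_atlasR3A00 mem_atlas
  haveI : NeZero ((c11642a1.e.baseChange ℚ).conductorNorm ℤ) := neZero_conductorNorm_of_isElliptic _
  intro Dt β ι d hσ hS₁ hS₂ hemb hne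
  haveI := Fact.mk (by norm_num : Nat.Prime 5)
  exact depthRowTwo_noTwist_of_print_of_intModel_certificate intModel h54 h43 h44 h53 h22 not_hasCM
    three_le_rank 5 (by norm_num) hasSurjectiveModNGaloisRep_pow_5 K hK hD (by norm_num) (by norm_num)
    heegner_neg7
    19 (by norm_num) (by norm_num) (by decide +kernel) (by norm_num) (by norm_num) (by norm_num)
    (by norm_num) (n₁ := 25) card_19 (by norm_num)
    59 (by norm_num) (by norm_num) (by decide +kernel) (by norm_num) (by norm_num) (by norm_num)
    (by norm_num) (n₂ := 60) card_59 (by norm_num) (by norm_num)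
    Dt β ι d hσ hS₁ hS₂ hemb hne

end C11642a1

namespace C13766a1

/-- `13766a1` is a curve of the rank-3 atlas table `atlasR3A00`. [cite: CremonaAlgorithms1997, Table 1 (13766a1)] -/
theorem mem_atlas : c13766a1 ∈ atlasR3A00 := by simp [atlasR3A00]

/-- The integral model `[1, 0, 1, -23, 42]` of `13766a1` is the tree's `integralModelInt` of the atlas curve.
[cite: CremonaAlgorithms1997, Table 1 (13766a1)] -/
theorem intModel :
    haveI := isElliptic_of_mem_atlasR3A00 mem_atlas;
    haveI := isGloballyMinimal_of_mem_atlasR3A00 mem_atlas;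
    integralModelInt (c13766a1.e.baseChange ℚ) = ⟨1, 0, 1, -23, 42⟩ := by
  haveI := isElliptic_of_mem_atlasR3A00 mem_atlas
  haveI := isGloballyMinimal_of_mem_atlasR3A00 mem_atlas
  exact IntModel.integralModelInt_eq_of_map_eq _ rfl

/-- `#Ẽ(𝔽_3) = 6`, `a_3 = -2` for `13766a1` (Mazur witness: `X² − a_3X + 3` is root-free mod `5`), kernel-decided.
[cite: CremonaAlgorithms1997, Table 1 (13766a1)] -/
theorem card_3 :
    Nat.card (((⟨1, 0, 1, -23, 42⟩ : WeierstrassCurve ℤ).map (Int.castRingHom (ZMod 3))).toAffine.Point) = 6 := by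
  rw [PointCountNat.natCard_point_map_eq (hℓ := ⟨by norm_num⟩) (by norm_num) 1 (0) 1 (-23) (42)
    (by decide +kernel)]
  decide +kernel

/-- **`5 ∈ B(13766a1)`: `ρ̄_{E,5^m}` onto for every `m`** (unconditional): semistable (`gcd(c₄, Δ) = 1`,
`c₄ = 1081`, `|Δ| = 2^4·6883^1`), `E[5]` irreducible by the Frobenius witness at `3` (Mazur) hence
`ρ̄_{E,5}` onto (Serre Prop. 21), and the multiplicative prime `6883` (`6883^1 ∥ Δ`, `5 ∤ 1`) lifts the image
to `GL₂(ℤ/5^m)`. [cite: Serre1972, §5.4 Prop. 21] [cite: SerreAbelianLadic1968, Ch. IV §3.4] -/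
theorem hasSurjectiveModNGaloisRep_pow_5 (m : ℕ) : (c13766a1.e.baseChange ℚ).HasSurjectiveModNGaloisRep (5 ^ m : ℕ) := by
  have hn : ∀ t : ZMod 5, t ^ 2 - (((3 : ℕ) : ℤ) + 1 - (6 : ℕ) : ℤ) * t + ((3 : ℕ) : ZMod 5) ≠ 0 := by
    decide +kernel
  haveI := isElliptic_of_mem_atlasR3A00 mem_atlas
  haveI := isGloballyMinimal_of_mem_atlasR3A00 mem_atlas
  haveI := Fact.mk (by norm_num : Nat.Prime 5)
  haveI := Fact.mk (by norm_num : Nat.Prime 3)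
  exact hasSurjectiveModNGaloisRep_pow_of_intModel_certificate intModel
    (by rw [Int.isCoprime_iff_gcd_eq_one]; decide +kernel) 5 3 (by norm_num) (by decide +kernel)
    (n := 6) card_3 hn 6883 (by norm_num) (by norm_num) (by decide +kernel) (by decide +kernel)
    (e := 1) (by decide +kernel) (by decide +kernel) (by decide +kernel) m

/-- **`13766a1` is not CM** (unconditional): multiplicative reduction at `6883` (`6883 ∣ Δ`, `6883 ∤ c₄ = 1081`);
a CM curve over `ℚ` has no multiplicative prime. [cite: SilvermanATAEC1994, Thm. II.6.4 (PDF p. 148)]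
[cite: CremonaAlgorithms1997, Table 1 (13766a1)] -/
theorem not_hasCM :
    haveI := isElliptic_of_mem_atlasR3A00 mem_atlas;
    ¬ (c13766a1.e.baseChange ℚ).HasCM := by
  haveI := isElliptic_of_mem_atlasR3A00 mem_atlas
  haveI := isGloballyMinimal_of_mem_atlasR3A00 mem_atlas
  haveI := Fact.mk (by norm_num : Nat.Prime 6883)
  intro hCM
  exact not_hasMultiplicativeReductionAtPrime_of_hasCM _ hCM 6883
    (IntModel.hasMultiplicativeReductionAtPrime_of_intModel intModel 6883 (by decide +kernel)
      (by decide +kernel))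

/-- **Heegner data `d_K = -7` for `13766a1`**: every prime of `|Δ| = 2^4·6883^1` splits in a quadratic field of
discriminant `-7` (Kronecker symbols `= 1`). [cite: Marcus1977, Ch. 3 Thm. 25] [cite: GrossLMS1991, §1] -/
theorem heegner_neg7 : ∀ q : ℕ, q.Prime → (q : ℤ) ∣ (⟨1, 0, 1, -23, 42⟩ : WeierstrassCurve ℤ).Δ →
    (q = 2 → (-7 : ℤ) % 8 = 1) ∧ (q ≠ 2 → jacobiSym (-7) q = 1) :=
  forall_prime_dvd_of_natAbs_eq_pow_mul_pow (a := 2) (i := 4) (b := 6883) (j := 1) (by decide +kernel)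
    (by norm_num) (by norm_num) ⟨by norm_num, by norm_num⟩ ⟨by norm_num, by norm_num⟩

/-- `#Ẽ(𝔽_59) = 75`, `a_59 = -15` (Kolyvagin prime for `(5, -7)`: `(-7/59) = −1`, `5 ∣ 60`, `5 ∣ a_59`),
kernel-decided. [cite: CremonaAlgorithms1997, Table 1 (13766a1)] -/
theorem card_59 :
    Nat.card (((⟨1, 0, 1, -23, 42⟩ : WeierstrassCurve ℤ).map (Int.castRingHom (ZMod 59))).toAffine.Point) = 75 := by
  rw [PointCountNat.natCard_point_map_eq (hℓ := ⟨by norm_num⟩) (by norm_num) 1 (0) 1 (-23) (42)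
    (by decide +kernel)]
  decide +kernel

/-- `#Ẽ(𝔽_139) = 145`, `a_139 = -5` (Kolyvagin prime for `(5, -7)`: `(-7/139) = −1`, `5 ∣ 140`, `5 ∣ a_139`),
kernel-decided. [cite: CremonaAlgorithms1997, Table 1 (13766a1)] -/
theorem card_139 :
    Nat.card (((⟨1, 0, 1, -23, 42⟩ : WeierstrassCurve ℤ).map (Int.castRingHom (ZMod 139))).toAffine.Point) = 145 := by
  rw [PointCountNat.natCard_point_map_eq (hℓ := ⟨by norm_num⟩) (by norm_num) 1 (0) 1 (-23) (42)
    (by decide +kernel)]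
  decide +kernel

/-- **`3 ≤ rank_ℤ E(ℚ)` for `13766a1`** (the tree's kernel census theorem `three_le_rank_of_mem_atlasR3A00`,
transported along `C.e ⊗ ℚ = C.row.curve`). [cite: CremonaAlgorithms1997, Table 1 (13766a1)] -/
theorem three_le_rank : 3 ≤ (c13766a1.e.baseChange ℚ).mordellWeilRank := by
  have hbc : c13766a1.e.baseChange ℚ = c13766a1.row.curve := by
    ext <;> simp [AtlasCurve3.e, Rank3Row.curve, WeierstrassCurve.baseChange]
  rw [hbc]
  exact three_le_rank_of_mem_atlasR3A00 mem_atlas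

/-- **DEPTH-TWO ROW `13766a1`, `(p, d_K, ℓ₁ℓ₂) = (5, -7, 59·139)`, twist-free, without Kolyvagin's
structure theorem.** For `E = 13766a1` (rank `3`), ANY imaginary quadratic `K` with `d_K = -7`, any frame
`(Dt, β, ι)` and any COMPATIBLE system `d n` of Kolyvagin–Heegner data, granted the five named leaves
(Gross Prop. 5.4 (2); McCallum Lemma 4.3, Prop. 4.4, Lemma 5.3, Prop. 2.2): IF
`(d (59 * 139)).kolyvaginClass _ 1 ≠ 0` THEN `corank_{ℤ_5} Ш(E)[5^∞] = 0`, `rank_ℤ E(ℚ) = 3`,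
`rank_ℤ E^{(-7)}(ℚ) ≤ 2`, `E(ℚ)[5] = 0`, `Ш(E/ℚ)[5] = 0`, `#Sel^(5)(E/ℚ) = 5³`, `#Sel^(5)(E^{(-7)}/ℚ) ≤ 5²`.
Every side condition is a kernel theorem. CONDITIONAL on the five facts and the bit; per-curve; BSD is not
proved by it. [cite: Kolyvagin1991MathAnn, Thm. 2.3] [cite: McCallumLMS1991, §§2–5]
[cite: GrossLMS1991, §5 (5.1)] [cite: CremonaAlgorithms1997, Table 1 (13766a1)] -/
theorem depthRow_5_neg7_59_139_noTwist
    (h54 : sign_conjAct_kolyvaginClass) (h43 : lemma43_kolyvaginClass_mem_selmerLocalKer)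
    (h44 : prop44_localOrder_kolyvaginClass_mul_eq) (h53 : lemma53_selmer_eigen_dependent_at)
    (h22 : prop22_reciprocity_eigen_finset)
    (K : Type) [Field K] [NumberField K] (hK : IsImaginaryQuadratic K)
    (hD : NumberField.discr K = -7) :
    haveI := isElliptic_of_mem_atlasR3A00 mem_atlas;
    haveI := isGloballyMinimal_of_mem_atlasR3A00 mem_atlas;
    haveI : NeZero ((c13766a1.e.baseChange ℚ).conductorNorm ℤ) := neZero_conductorNorm_of_isElliptic _;
    ∀ (Dt : ModularParametrizationData (c13766a1.e.baseChange ℚ) ((c13766a1.e.baseChange ℚ).conductorNorm ℤ))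
      (β : ℤ) (ι : K →+* ℂ) (d : ∀ m : ℕ, KolyvaginHeegnerData Dt β ι m),
    (∀ (m l : ℕ), ∀ l' ∈ m.primeFactors, ∀ (x : ringClassField K ι m)
      (x' : ringClassField K ι (m * l)),
      (x : ℂ) = x' → (((d (m * l)).σ l' x' : ringClassField K ι (m * l)) : ℂ) = ((d m).σ l' x : ℂ)) →
    (∀ (m l : ℕ), ∀ s ∈ (d m).S, ∃ s' ∈ (d (m * l)).S, ∀ (x : ringClassField K ι m)
      (x' : ringClassField K ι (m * l)),
      (x : ℂ) = x' → ((s' x' : ringClassField K ι (m * l)) : ℂ) = (s x : ℂ)) →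
    (∀ (m l : ℕ), ∀ s' ∈ (d (m * l)).S, ∃ s ∈ (d m).S, ∀ (x : ringClassField K ι m)
      (x' : ringClassField K ι (m * l)),
      (x : ℂ) = x' → ((s' x' : ringClassField K ι (m * l)) : ℂ) = (s x : ℂ)) →
    (∀ (m l : ℕ) (x : ringClassField K ι m) (x' : ringClassField K ι (m * l)),
      (x : ℂ) = x' → (d (m * l)).emb x' = (d m).emb x) →
    (d (59 * 139)).kolyvaginClass (p := 5) (by norm_num) 1 ≠ 0 →
    (c13766a1.e.baseChange ℚ).shaCorank 5 = 0 ∧ (c13766a1.e.baseChange ℚ).mordellWeilRank = 3 ∧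
      ((c13766a1.e.baseChange ℚ).quadraticTwist ((-7 : ℤ) : ℚ)).mordellWeilRank ≤ 2 ∧
      (∀ P : (c13766a1.e.baseChange ℚ).toAffine.Point, 5 • P = 0 → P = 0) ∧
      (∀ x ∈ (c13766a1.e.baseChange ℚ).sha, 5 • x = 0 → x = 0) ∧
      Nat.card ↥(selmerGroup (c13766a1.e.baseChange ℚ) ((5 : ℕ) : ℤ)) = 5 ^ 3 ∧
      Nat.card ↥(selmerGroup ((c13766a1.e.baseChange ℚ).quadraticTwist ((-7 : ℤ) : ℚ)) ((5 : ℕ) : ℤ)) ≤ 5 ^ 2 := by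
  haveI := isElliptic_of_mem_atlasR3A00 mem_atlas
  haveI := isGloballyMinimal_of_mem_atlasR3A00 mem_atlas
  haveI : NeZero ((c13766a1.e.baseChange ℚ).conductorNorm ℤ) := neZero_conductorNorm_of_isElliptic _
  intro Dt β ι d hσ hS₁ hS₂ hemb hne
  haveI := Fact.mk (by norm_num : Nat.Prime 5)
  exact depthRowTwo_noTwist_of_print_of_intModel_certificate intModel h54 h43 h44 h53 h22 not_hasCM
    three_le_rank 5 (by norm_num) hasSurjectiveModNGaloisRep_pow_5 K hK hD (by norm_num) (by norm_num)
    heegner_neg7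
    59 (by norm_num) (by norm_num) (by decide +kernel) (by norm_num) (by norm_num) (by norm_num)
    (by norm_num) (n₁ := 75) card_59 (by norm_num)
    139 (by norm_num) (by norm_num) (by decide +kernel) (by norm_num) (by norm_num) (by norm_num)
    (by norm_num) (n₂ := 145) card_139 (by norm_num) (by norm_num)
    Dt β ι d hσ hS₁ hS₂ hemb hne

end C13766a1

end Summit.BirchSwinnertonDyer.BirchSwinnertonDyer.Theorems.KolyvaginDepthDoor

end
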